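import Mathlib
import Summits.ResolutionOfSingularities.ResolutionOfSingularities.Theorems.HomologicalConductorPersistencePointedCycles
import Summits.ResolutionOfSingularities.ResolutionOfSingularities.Theorems.HomologicalConductorPersistencePointedCyclesDefinite
import HarnessLib

/-!
# Rung S-2 `PersistenceSurface` (stmt-ResolutionOfSingularities-19970) — POINTED CYCLES III: the PARITY CRITERION for
# NP(t) (`A⁽ᵗ⁾ = 0`) at a curve fixed by a symmetry (memo K-PCC §3; res-L1-w44b-lead-1 g4)

Route `ResolutionOfSingularities/HomologicalConductor`, chain W4.4b, rung S-2 `PersistenceSurface` (stmt-19970), stub C3′ /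
local core.  `[OURS · L1 w44b]`; replaces the role of no printed item; NOT a statement of the manuscript under review
(Hironaka 2017); AI-written elementary lattice arithmetic, weaker than expert review.  Def-free; sequel of
`…PersistencePointedCycles` (p564614) and `…PersistencePointedCyclesDefinite` (p565092).

## Why
The chain-arrival persistence theorem of memo K-PCC (Thm 4.3 / Cor 4.4; refereed, tri-1 REFEREE-K-PCC-EK2 v2) needs on
the stage `T` the condition NP(t): every effective cycle `A` with `A·C_i ≥ −δ_it` is `0` — and for an `A_ℓ`-arrival
only at the MIDDLE curve of the contracted path (the pyramid lemma uses a single corner).  The box criterion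
`(−M⁻¹)_tt < 1` is sufficient but not necessary (cusp cycles violate it and satisfy NP).  A second, purely combinatorial
criterion:

**Parity criterion.** Let `σ` be an involutive symmetry of the weighted dual graph (`M (σ i) (σ j) = M i j`,
`σ (σ i) = i`) with `σ t = t`, such that `C_t² = M t t` is EVEN and every `σ`-FIXED curve `j ≠ t` meets `C_t` evenly
(`M j t` even — vacuous when `σ` moves all neighbours of `C_t`).  Then NP(t) holds.  Proof: for `A ∈ 𝒜_t` also
`A ∘ σ ∈ 𝒜_t`, so `B := A ⊔ (A ∘ σ) ∈ 𝒜_t` (Artin, p564614) and `B ∘ σ = B`; in `B·C_t = Σ_j B_j M j t` the `σ`-moved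
indices pair off with equal summands, the fixed ones are even: `B·C_t` is even, hence `≠ −1`, hence `≥ 0`; so `B` is nef
and effective, `B ≤ 0` by negative definiteness (p565092 `nonpos_of_nef`), and `0 ≤ A ≤ B = 0`.
INSTANCES: the middle curve of a (−2)-path of odd length reversed by a symmetry of the whole configuration (the `z`-chain of
`T_{p,p,r}`; palindromic cusp cycles; symmetric stars), any (−2)-curve whose two neighbours are swapped by a symmetry.
CONSEQUENCE (K-PCC Thm 4.3 + pyramid lemma): an `A_ℓ`-arrival with `ℓ` odd whose path is reversed by a symmetry of the
stage's resolution graph is KEPT as soon as `x ∈ ca³(T)` — no discriminant computation needed.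

* `even_sum_of_involution` — a sum over a finite set carrying a fixed-point-free involution `σ` with `f ∘ σ = f` is even;
* `sum_comp_mul_eq` — equivariance `(A∘σ)·C_i = A·C_{σ i}`; `comp_isPointedAlmostNef` — `𝒜_t` is `σ`-stable;
* `even_pairing_of_invariant` — for `σ`-invariant `B`: `B·C_t` is even under the parity hypotheses;
* **`eq_zero_of_isPointedAlmostNef_of_symmetry`** — the parity criterion NP(t).

References (mechanism only): M. Artin, Amer. J. Math. 88 (1966) (negative definiteness; the max-argument); this work
(memo K-PCC §3, evidence on stmt-19970).
-/

-- single-problem summit: the doubled namespace component `ResolutionOfSingularities` is forced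
set_option linter.dupNamespace false

namespace Summit.ResolutionOfSingularities.ResolutionOfSingularities.Theorems.HomologicalConductor.PersistencePointedCyclesParity

open Finset
open Summit.ResolutionOfSingularities.ResolutionOfSingularities.Theorems.HomologicalConductor.PersistencePointedCycles
  (sup_isPointedAlmostNef)
open Summit.ResolutionOfSingularities.ResolutionOfSingularities.Theorems.HomologicalConductor.PersistencePointedCyclesDefinite
  (nonpos_of_nef)

/-! ## A sum invariant under a fixed-point-free involution is even -/

/-- **Orbit pairing.** If a finite set `s` carries a fixed-point-free involution `σ` (`σ s ⊆ s`, `σ j ≠ j`, `σ (σ j) = j`)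
and `f (σ j) = f j` on `s`, then `Σ_{j∈s} f j` is even (remove an orbit `{j, σ j}`, contributing `2·f j`, and induct).
[folklore] -/
theorem even_sum_of_involution {α : Type*} [DecidableEq α] (σ : α → α) (f : α → ℤ) :
    ∀ (s : Finset α), (∀ j ∈ s, σ j ∈ s) → (∀ j ∈ s, σ j ≠ j) → (∀ j ∈ s, σ (σ j) = j) →
      (∀ j ∈ s, f (σ j) = f j) → Even (∑ j ∈ s, f j) := by
  intro s
  induction s using Finset.strongInduction with
  | H s ih =>
    intro hs hfp hσσ hf
    rcases s.eq_empty_or_nonempty with rfl | ⟨j, hj⟩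
    · simp
    · have hσj : σ j ∈ s := hs j hj
      have hne : σ j ≠ j := hfp j hj
      set s' := (s.erase j).erase (σ j) with hs'
      have hsub : s' ⊂ s := lt_of_le_of_lt (erase_subset _ _) (erase_ssubset hj)
      have hmem' : ∀ k, k ∈ s' ↔ k ∈ s ∧ k ≠ j ∧ k ≠ σ j := fun k => by
        rw [hs', mem_erase, mem_erase]; tauto
      -- the orbit-free remainder is again `σ`-stable
      have hs's : ∀ k ∈ s', σ k ∈ s' := fun k hk => by
        rw [hmem'] at hk ⊢
        refine ⟨hs k hk.1, fun h => hk.2.2 ?_, fun h => hk.2.1 ?_⟩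
        · rw [← h, hσσ k hk.1]
        · have := congrArg σ h; rwa [hσσ k hk.1, hσσ j hj] at this
      have heven' : Even (∑ k ∈ s', f k) :=
        ih s' hsub hs's (fun k hk => hfp k ((hmem' k).1 hk).1) (fun k hk => hσσ k ((hmem' k).1 hk).1)
          fun k hk => hf k ((hmem' k).1 hk).1
      -- Σ_s f = f j + f (σ j) + Σ_{s'} f = 2 f j + Σ_{s'} f
      have hsplit : ∑ k ∈ s, f k = f j + (f (σ j) + ∑ k ∈ s', f k) := by
        rw [← add_sum_erase s f hj, ← add_sum_erase (s.erase j) f (mem_erase.2 ⟨hne, hσj⟩)]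
      rw [hsplit, hf j hj, ← add_assoc, ← two_mul]
      exact (even_two_mul _).add heven'

/-! ## Symmetries of the configuration -/

variable {ι : Type*} [Fintype ι] [DecidableEq ι]

omit [DecidableEq ι] in
/-- **Equivariance of the pairing.** For an involutive symmetry `σ` of `M`: `(A ∘ σ)·C_i = A·C_{σ i}`. [folklore] -/
theorem sum_comp_mul_eq (M : ι → ι → ℤ) (σ : ι → ι) (hσM : ∀ i j, M (σ i) (σ j) = M i j)
    (hσσ : ∀ i, σ (σ i) = i) (A : ι → ℕ) (i : ι) :
    ∑ j, ((A (σ j) : ℕ) : ℤ) * M j i = ∑ j, (A j : ℤ) * M j (σ i) := by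
  have hbij : Function.Bijective σ := Function.Involutive.bijective hσσ
  refine Fintype.sum_bijective σ hbij _ _ fun j => ?_
  rw [← hσM j i]

/-- **`𝒜_t` is stable under a symmetry fixing `t`.** [this work] -/
theorem comp_isPointedAlmostNef (M : ι → ι → ℤ) (σ : ι → ι) (hσM : ∀ i j, M (σ i) (σ j) = M i j)
    (hσσ : ∀ i, σ (σ i) = i) (t : ι) (hσt : σ t = t) {A : ι → ℕ}
    (hA : ∀ i, -(if i = t then (1 : ℤ) else 0) ≤ ∑ j, (A j : ℤ) * M j i) :
    ∀ i, -(if i = t then (1 : ℤ) else 0) ≤ ∑ j, ((A ∘ σ) j : ℤ) * M j i := by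
  intro i
  have hiff : (σ i = t) ↔ (i = t) := by
    constructor
    · intro h1; have := congrArg σ h1; rwa [hσσ, hσt] at this
    · intro h1; rw [h1, hσt]
  have h := hA (σ i)
  simp only [hiff] at h
  simp only [Function.comp_apply]
  rw [sum_comp_mul_eq M σ hσM hσσ A i]
  exact h

omit [DecidableEq ι] in
/-- **Parity of the pairing of an invariant cycle at a fixed curve.** If `B ∘ σ = B`, `σ t = t`, `M t t` is even and
`M j t` is even for every `σ`-fixed `j ≠ t`, then `B·C_t = Σ_j B_j·M j t` is even. [this work] -/
theorem even_pairing_of_invariant [DecidableEq ι] (M : ι → ι → ℤ) (σ : ι → ι)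
    (hσM : ∀ i j, M (σ i) (σ j) = M i j) (hσσ : ∀ i, σ (σ i) = i) (t : ι) (hσt : σ t = t) (htt : Even (M t t))
    (hfix : ∀ j, j ≠ t → σ j = j → Even (M j t)) (B : ι → ℕ) (hB : ∀ j, B (σ j) = B j) :
    Even (∑ j, (B j : ℤ) * M j t) := by
  rw [← sum_filter_add_sum_filter_not univ (fun j => σ j = j)]
  refine Even.add ?_ ?_
  · -- fixed points: each summand is even
    refine even_sum _ fun j hj => ?_
    rw [mem_filter] at hj
    by_cases hjt : j = t
    · subst hjt; exact htt.mul_left _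
    · exact (hfix j hjt hj.2).mul_left _
  · -- moved points: orbit pairing
    refine even_sum_of_involution σ (fun j => (B j : ℤ) * M j t) _ (fun j hj => ?_) (fun j hj => ?_)
      (fun j _ => hσσ j) (fun j _ => ?_)
    · rw [mem_filter] at hj ⊢
      exact ⟨mem_univ _, fun h => hj.2 (h.symm.trans (hσσ j))⟩
    · rw [mem_filter] at hj; exact hj.2
    · show (B (σ j) : ℤ) * M (σ j) t = (B j : ℤ) * M j t
      rw [hB j, ← hσM (σ j) t, hσσ, hσt]

/-! ## The parity criterion for NP(t) -/

/-- **NP(t) by parity** (memo K-PCC §3, addendum).  Let `M` have non-negative off-diagonal entries and be negative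
definite (`hneg`), and let `σ` be an involutive symmetry of `M` fixing `t` with `M t t` even and `M j t` even for every
`σ`-fixed `j ≠ t`.  Then every effective cycle `A` with `A·C_i ≥ −δ_it ∀ i` vanishes: `𝒜_t = {0}`, `A⁽ᵗ⁾ = 0`.
Hence (K-PCC Thm 4.3 + pyramid lemma) an `A_ℓ`-arrival, `ℓ` odd, whose path is reversed by a symmetry of the stage's
resolution graph is KEPT as soon as `x ∈ ca³(T)`. [this work] -/
theorem eq_zero_of_isPointedAlmostNef_of_symmetry (M : ι → ι → ℤ) (hoff : ∀ i j, i ≠ j → 0 ≤ M i j)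
    (hneg : ∀ N : ι → ℤ, 0 ≤ ∑ i, N i * ∑ j, N j * M j i → N = 0)
    (σ : ι → ι) (hσM : ∀ i j, M (σ i) (σ j) = M i j) (hσσ : ∀ i, σ (σ i) = i) (t : ι) (hσt : σ t = t)
    (htt : Even (M t t)) (hfix : ∀ j, j ≠ t → σ j = j → Even (M j t))
    {A : ι → ℕ} (hA : ∀ i, -(if i = t then (1 : ℤ) else 0) ≤ ∑ j, (A j : ℤ) * M j i) : A = 0 := by
  -- symmetrise: B = A ⊔ (A ∘ σ) is almost nef at t and σ-invariant
  set B : ι → ℕ := A ⊔ (A ∘ σ) with hBdef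
  have hB : ∀ i, -(if i = t then (1 : ℤ) else 0) ≤ ∑ j, (B j : ℤ) * M j i :=
    sup_isPointedAlmostNef hoff t hA (comp_isPointedAlmostNef M σ hσM hσσ t hσt hA)
  have hBinv : ∀ j, B (σ j) = B j := fun j => by
    simp only [hBdef, Pi.sup_apply, Function.comp_apply, hσσ]; exact sup_comm _ _
  -- its pairing with C_t is even and ≥ −1, hence ≥ 0; elsewhere ≥ 0 directly: B is nef
  have hnef : ∀ i, 0 ≤ ∑ j, (B j : ℤ) * M j i := by
    intro i
    by_cases hit : i = t
    · subst hit
      have h1 := hB i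
      simp only [if_true] at h1
      obtain ⟨c, hc⟩ := even_pairing_of_invariant M σ hσM hσσ i hσt htt hfix B hBinv
      omega
    · have h1 := hB i
      simp only [hit, if_false, neg_zero] at h1
      exact h1
  -- negative definiteness: an effective nef cycle is 0
  have hle := nonpos_of_nef M hoff hneg (fun j => (B j : ℤ)) hnef
  funext i
  have hBi : B i = 0 := by have := hle i; simp only [Pi.zero_apply] at this; omega
  have hAi : A i ≤ B i := by simp only [hBdef, Pi.sup_apply]; exact le_sup_left
  rw [hBi] at hAi
  simpa using hAi

end Summit.ResolutionOfSingularities.ResolutionOfSingularities.Theorems.HomologicalConductor.PersistencePointedCyclesParity
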